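import Summits.ResolutionOfSingularities.ResolutionOfSingularities.Theorems.DescentDescentPerfectToAllLaurentPDegree
import Literature.FieldTheory.Separability.PDegreeSeparablyGenerated
import Mathlib.RingTheory.Algebraic.Cardinality
import Literature.AlgebraicGeometry.Resolution.ValuationDefectExample
import Mathlib.RingTheory.AlgebraicIndependent.TranscendenceBasis
import Mathlib.LinearAlgebra.Dimension.Free
import HarnessLib

/-!
# `DescentPerfectToAll` (stmt-ResolutionOfSingularities-0549): the residual class is inhabited —
# `𝔽_p((X))` is not EFT-separably exhausted

Route `ResolutionOfSingularities/Descent`, crux `DescentPerfectToAll`. Helper (OURS; not a statement of any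
manuscript; `--supports` the crux, does not close it).

`DescentDescentPerfectToAllExhaustion.lean` proves the crux's conclusion, given its antecedent, over every
**EFT-separably exhausted** field `k` — every finite `s ⊆ k` lies in a subfield `E` essentially of finite type
over some perfect field with `k/E` separable in Mac Lane's sense — and restates the crux as resolution over
the COMPLEMENT of this class (`descentPerfectToAll_iff_residual`). That the complement is non-empty was so
far only an informal remark (docstrings; the route's BARRIERS paragraph: "for `k = 𝔽_p((t))`, `[k : k^p] = p`
while `K₀` of transcendence degree `d` has an absolute `p`-basis of `d` elements that must stay
`p`-independent in `k` — impossible for `d ≥ 2`"). This file makes it a kernel theorem: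

* `linearIndependent_frobenius_of_macLane` — **Mac Lane symmetry**: if `E ≤ K` and `E`-linearly
  independent finite families of `K` have `E`-linearly independent `p`-th powers (the tree's form of
  "`K/E` separable"), then every `E^p`-linearly independent finite family IN `E` is `K^p`-linearly
  independent in `K` (linear disjointness of `E` and `K^p` over `E^p`, read from the other side);
* `exists_transcendental_adjoin_laurentSeries`, `exists_algebraicIndependent_pair_laurentSeries`,
  `algebraicIndependent_of_ringHom_eq` — two algebraically independent Laurent series (cardinality), and
  transport of algebraic independence from `ℤ/p` to an abstract field `k₀` whose image in the target is
  the prime field;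
* `not_exhaustedByEssFiniteType_of_pRank_le_one` — **abstract witness criterion**: a field `K` of
  characteristic `p` with (a) `[K : K^p] ≤ p` (every `K^p`-free finite family has `≤ p` members), (b) only
  the prime field as image of perfect fields, (c) two algebraically independent elements, is NOT
  EFT-separably exhausted. Proof: for `E ∋ x` essentially of finite type over a perfect `k₀` (whose image
  is `𝔽_p` by (b)), `[E : E^p] = p^{tr.deg E} ≥ p²` (tree
  `Literature.FieldTheory.Separability.exists_finrank_frobenius_eq_pow_card`, Matsumura Thm. 26.5); Mac
  Lane symmetry moves an `E^p`-basis of `E` to a `K^p`-free family of `p^{tr.deg E}` elements of `K`,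
  against (a);
* `not_exhaustedByEssFiniteType_laurentSeries` — **THE WITNESS**: `K = 𝔽_p((X))` satisfies (a)
  (`card_le_of_linearIndependent_frobenius_laurentSeries`), (b) (`laurentSeries_ringHom_eq_C_of_perfectField`)
  and (c), so it is not EFT-separably exhausted;
* `exists_field_not_exhaustedByEssFiniteType` — packaged: for every prime `p` there is a field of
  characteristic `p` (in `Type`) outside the master class of
  `hasResolution_of_perfectRes_of_exhaustedByEssFiniteType`; that theorem therefore does NOT by itself
  settle the crux, whose residual (`descentPerfectToAll_iff_residual`) is a statement about such fields
  (a COUNTABLE inhabitant follows in `DescentDescentPerfectToAllResidualWitnessCountable.lean`).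

No claim about the crux itself is made. [cite: Matsumura1987, Thm. 26.4 (Mac Lane) and Thm. 26.5;
EGAIV2, Prop. 6.7.4] [folklore]
-/

noncomputable section

set_option linter.dupNamespace false -- mandated namespace of this single-conjunct summit

open scoped LaurentSeries

namespace Summit.ResolutionOfSingularities.ResolutionOfSingularities.Theorems

universe u

/-! ## Mac Lane symmetry -/

/-- **Mac Lane symmetry** (linear disjointness of `E` and `K^p` over `E^p`, read from the `E`-side): if
`E`-linearly independent finite families of `K` have `E`-linearly independent `p`-th powers, then an
`E^p`-linearly independent finite family of elements of `E` is `K^p`-linearly independent in `K`. Proof: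
given `∑ y_i^p b_i = 0`, expand the `y_i` in a maximal `E`-independent subfamily `w` of themselves,
`y_i = ∑_x a_{ix} x`; then `∑_x (∑_i a_{ix}^p b_i) x^p = 0`, the hypothesis kills every `∑_i a_{ix}^p b_i`,
and `E^p`-independence of `b` kills every `a_{ix}`. [cite: Matsumura1987, Thm. 26.4] -/
theorem linearIndependent_frobenius_of_macLane {K : Type u} [Field K] (p : ℕ) [Fact p.Prime]
    [CharP K p] (E : Subfield K)
    (hML : ∀ u : Finset K, LinearIndepOn E _root_.id (↑u : Set K) →
      LinearIndepOn E (fun x : K => x ^ p) (↑u : Set K))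
    [CharP E p] {ι : Type*} [Fintype ι] (b : ι → E)
    (hb : LinearIndependent (frobenius E p).fieldRange b) :
    LinearIndependent (frobenius K p).fieldRange (fun i => (b i : K)) := by
  classical
  have hp : p.Prime := Fact.out
  rw [Fintype.linearIndependent_iff] at hb ⊢
  intro g hg i₀
  -- `p`-th roots of the coefficients
  have hroot : ∀ i, ∃ y : K, y ^ p = (g i : K) := fun i => RingHom.mem_fieldRange.mp (g i).2
  choose y hy using hroot
  -- a maximal `E`-linearly independent subfamily `w` of the `y i`
  obtain ⟨c, hcT, hspan, hlin⟩ := exists_linearIndependent E (Set.range y)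
  have hcfin : c.Finite := (Set.finite_range y).subset hcT
  set w : Finset K := hcfin.toFinset with hw
  have hwc : (↑w : Set K) = c := hcfin.coe_toFinset
  have hwlin : LinearIndepOn E _root_.id (↑w : Set K) := by
    rw [hwc]
    exact hlin
  -- coordinates `y i = ∑_{x ∈ w} a i x · x`
  have hcoord : ∀ i, ∃ a : K → E, y i = ∑ x ∈ w, (a x : K) * x := by
    intro i
    have hyi : y i ∈ Submodule.span E (↑w : Set K) := by
      rw [hwc, hspan]
      exact Submodule.subset_span ⟨i, rfl⟩
    obtain ⟨a, -, ha⟩ := Submodule.mem_span_finset.mp hyi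
    refine ⟨a, ?_⟩
    rw [← ha]
    exact Finset.sum_congr rfl fun x _ => by rw [Subfield.smul_def, smul_eq_mul]
  choose a ha using hcoord
  -- the relation, rearranged along `w`
  have hgi : ∀ i, ((g i : K)) = ∑ x ∈ w, ((a i x : E) : K) ^ p * x ^ p := by
    intro i
    rw [← hy i, ha i, sum_pow_char]
    exact Finset.sum_congr rfl fun x _ => mul_pow _ _ _
  have hrel : ∑ x ∈ w, ((∑ i, a i x ^ p * b i : E) : K) * x ^ p = 0 := by
    have h1 : ∀ x ∈ w, ((∑ i, a i x ^ p * b i : E) : K) * x ^ p =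
        ∑ i, ((a i x : E) : K) ^ p * x ^ p * (b i : K) := by
      intro x _
      push_cast
      rw [Finset.sum_mul]
      exact Finset.sum_congr rfl fun i _ => by ring
    rw [Finset.sum_congr rfl h1, Finset.sum_comm]
    have h2 : ∀ i, ∑ x ∈ w, ((a i x : E) : K) ^ p * x ^ p * (b i : K) = (g i : K) * (b i : K) := by
      intro i
      rw [hgi i, Finset.sum_mul]
    rw [Finset.sum_congr rfl fun i _ => h2 i]
    have h3 : ∑ i, g i • ((b i : E) : K) = ∑ i, (g i : K) * (b i : K) :=
      Finset.sum_congr rfl fun i _ => by rw [Subfield.smul_def, smul_eq_mul]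
    rw [← h3]
    exact hg
  -- Mac Lane on `w`: every coefficient `∑_i a i x ^ p * b i` vanishes
  have hβ : ∀ x ∈ w, (∑ i, a i x ^ p * b i : E) = 0 := by
    have hML' := hML w hwlin
    rw [LinearIndepOn, linearIndependent_iff'] at hML'
    intro x hx
    refine hML' Finset.univ (fun z => ∑ i, a i (z : K) ^ p * b i) ?_ ⟨x, hx⟩ (Finset.mem_univ _)
    rw [← hrel, ← Finset.sum_coe_sort w]
    exact Finset.sum_congr rfl fun z _ => by rw [Subfield.smul_def, smul_eq_mul]
  -- `E^p`-independence of `b`: every `a i x` vanishes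
  have ha0 : ∀ x ∈ w, ∀ i, a i x = 0 := by
    intro x hx
    have hmem : ∀ i, a i x ^ p ∈ (frobenius E p).fieldRange := fun i =>
      RingHom.mem_fieldRange.mpr ⟨a i x, rfl⟩
    have h := hb (fun i => ⟨a i x ^ p, hmem i⟩) (by
      rw [← hβ x hx]
      exact Finset.sum_congr rfl fun i _ => by rw [Subfield.smul_def, smul_eq_mul])
    intro i
    have hi : a i x ^ p = 0 := congrArg Subtype.val (h i)
    exact pow_eq_zero_iff hp.ne_zero |>.mp hi
  have hy0 : y i₀ = 0 := by
    rw [ha i₀]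
    exact Finset.sum_eq_zero fun x hx => by rw [ha0 x hx i₀, ZeroMemClass.coe_zero, zero_mul]
  apply Subtype.ext
  rw [← hy i₀, hy0, zero_pow hp.ne_zero]
  rfl

/-! ## Two algebraically independent Laurent series, seen from an abstract perfect field -/

variable (p : ℕ) [Fact p.Prime]

/-- Over the subalgebra generated by any `u ∈ 𝔽_p((X))` there is a transcendental Laurent series (the
subalgebra is countable, `𝔽_p((X))` is not). [folklore] -/
theorem exists_transcendental_adjoin_laurentSeries (u : (ZMod p)⸨X⸩) :
    ∃ z : (ZMod p)⸨X⸩, Transcendental (Algebra.adjoin (ZMod p) {u}) z := by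
  by_contra h
  simp only [not_exists, Transcendental, not_not] at h
  haveI : Algebra.IsAlgebraic (Algebra.adjoin (ZMod p) {u}) ((ZMod p)⸨X⸩) := ⟨h⟩
  haveI : Countable (Algebra.adjoin (ZMod p) ({u} : Set ((ZMod p)⸨X⸩))) := by
    have hpoly : Countable (Polynomial (ZMod p)) := by
      rw [← Cardinal.mk_le_aleph0_iff]
      exact Polynomial.cardinalMk_le_max.trans (max_le Cardinal.mk_le_aleph0 le_rfl)
    rw [Algebra.adjoin_singleton_eq_range_aeval]
    exact Set.countable_range _ |>.to_subtype
  have hle := Algebra.IsAlgebraic.cardinalMk_le_max (Algebra.adjoin (ZMod p) ({u} : Set ((ZMod p)⸨X⸩)))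
    ((ZMod p)⸨X⸩)
  have hM : Cardinal.mk ((ZMod p)⸨X⸩) ≤ Cardinal.aleph0 :=
    hle.trans (max_le Cardinal.mk_le_aleph0 le_rfl)
  exact Literature.AlgebraicGeometry.Resolution.not_countable_laurentSeries p
    (Cardinal.mk_le_aleph0_iff.mp hM)

/-- Two algebraically independent Laurent series over `𝔽_p`, as an `Option (Fin 1)`-indexed family.
[folklore] -/
theorem exists_algebraicIndependent_pair_laurentSeries :
    ∃ u₁ u₂ : (ZMod p)⸨X⸩,
      AlgebraicIndependent (ZMod p) (fun o : Option (Fin 1) => o.elim u₂ ![u₁]) := by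
  obtain ⟨u₁, hu₁⟩ := exists_transcendental_adjoin_laurentSeries p 0
  obtain ⟨u₂, hu₂⟩ := exists_transcendental_adjoin_laurentSeries p u₁
  refine ⟨u₁, u₂, AlgebraicIndependent.option_iff.mpr ⟨?_, ?_⟩⟩
  · rw [algebraicIndependent_iff_transcendental]
    exact hu₁.restrictScalars (R := ZMod p) (algebraMap (ZMod p) _).injective
  · have hr : Set.range ![u₁] = {u₁} := by
      ext z
      simp
    rw [hr]
    exact hu₂

/-- **Transport of algebraic independence to an abstract ground field with prime image**: if
`ψ : A → K` is a ring map from a `k₀`-algebra `A` (`char k₀ = p`) to a field `K` such that every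
`ψ (algebraMap k₀ A a)` is in the image of `ℤ/p` (so `ℤ/p → k₀` is onto), and `ψ ∘ x` is algebraically
independent over `ℤ/p`, then `x` is algebraically independent over `k₀` (`aeval (ψ ∘ x) = ψ ∘ aeval x ∘ map`,
with `map : (ℤ/p)[X_ι] → k₀[X_ι]` onto). [folklore] -/
theorem algebraicIndependent_of_ringHom_eq {k₀ : Type*} [Field k₀] [CharP k₀ p] {A K : Type*}
    [CommRing A] [Algebra k₀ A] [Field K] [Algebra (ZMod p) K]
    (ψ : A →+* K)
    (hφ : ∀ a : k₀, ∃ c : ZMod p, ψ (algebraMap k₀ A a) = algebraMap (ZMod p) K c)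
    {ι : Type*} (x : ι → A) (hx : AlgebraicIndependent (ZMod p) (fun i => ψ (x i))) :
    AlgebraicIndependent k₀ x := by
  classical
  -- `ℤ/p → k₀` is surjective
  set ι₀ : ZMod p →+* k₀ := ZMod.castHom (dvd_refl p) k₀ with hι₀
  have hcomp : (ψ.comp (algebraMap k₀ A)).comp ι₀ = algebraMap (ZMod p) K := Subsingleton.elim _ _
  have hinjA : Function.Injective (ψ.comp (algebraMap k₀ A)) :=
    (ψ.comp (algebraMap k₀ A)).injective
  have hsurj : Function.Surjective ι₀ := by
    intro a
    obtain ⟨c, hc⟩ := hφ a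
    refine ⟨c, hinjA ?_⟩
    have h1 := RingHom.congr_fun hcomp c
    rw [RingHom.comp_apply] at h1
    rw [h1, RingHom.comp_apply]
    exact hc.symm
  -- `ψ ∘ aeval x ∘ map ι₀ = aeval (ψ ∘ x)`
  have hkey : ∀ Q : MvPolynomial ι (ZMod p),
      ψ (MvPolynomial.aeval x (MvPolynomial.map ι₀ Q)) = MvPolynomial.aeval (fun i => ψ (x i)) Q := by
    intro Q
    have h := MvPolynomial.ringHom_ext (σ := ι) (R := ZMod p)
      (f := ψ.comp ((MvPolynomial.aeval x).toRingHom.comp (MvPolynomial.map ι₀)))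
      (g := (MvPolynomial.aeval (fun i => ψ (x i))).toRingHom) (fun c => ?_) (fun i => ?_)
    · exact congrArg (fun F => F Q) (congrArg DFunLike.coe h)
    · have hc := RingHom.congr_fun hcomp c
      simp only [RingHom.comp_apply] at hc
      simp only [RingHom.comp_apply, AlgHom.toRingHom_eq_coe, RingHom.coe_coe, MvPolynomial.map_C,
        MvPolynomial.aeval_C]
      exact hc
    · simp only [RingHom.comp_apply, AlgHom.toRingHom_eq_coe, RingHom.coe_coe, MvPolynomial.map_X,
        MvPolynomial.aeval_X]
  rw [algebraicIndependent_iff_injective_aeval] at hx ⊢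
  rw [injective_iff_map_eq_zero]
  intro P hP
  obtain ⟨Q, rfl⟩ := MvPolynomial.map_surjective ι₀ hsurj P
  have hQ : MvPolynomial.aeval (fun i => ψ (x i)) Q = 0 := by
    rw [← hkey Q, hP, map_zero]
  rw [(injective_iff_map_eq_zero _).mp hx Q hQ, map_zero]

/-! ## The witness -/

/-- **Fields of `p`-rank `≤ 1` with trivial perfect subfields and transcendence degree `≥ 2` are not
EFT-separably exhausted.** Let `K` have characteristic `p` and suppose: (a) every finite `K^p`-linearly
independent family in `K` has at most `p` members; (b) every ring map from a perfect field into `K` takes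
values in the prime field; (c) `K` contains a finite algebraically independent family `x` over `ℤ/p` with
at least two members. Then for NO perfect `k₀` and subfield `E ≤ K` essentially of finite type over `k₀`
containing the `x i` is `K/E` separable in Mac Lane's sense: by (b) the image of `k₀` is the prime field,
so `x` stays algebraically independent over `k₀` in `E` and `[E : E^p] = p^{tr.deg_{k₀} E} ≥ p²`
(Matsumura Thm. 26.5, tree `exists_finrank_frobenius_eq_pow_card`); Mac Lane symmetry moves an
`E^p`-basis of `E` to a `K^p`-linearly independent family of `p^{tr.deg E}` members, against (a). The
conclusion is the negation of the hypothesis of `hasResolution_of_perfectRes_of_exhaustedByEssFiniteType`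
for `k = K` (verbatim shape). [cite: Matsumura1987, Thm. 26.4 and Thm. 26.5; EGAIV2, Prop. 6.7.4] -/
theorem not_exhaustedByEssFiniteType_of_pRank_le_one (K : Type) [Field K] [CharP K p]
    [Algebra (ZMod p) K]
    (hrank : ∀ (n : ℕ) (v : Fin n → K), LinearIndependent (frobenius K p).fieldRange v → n ≤ p)
    (hperf : ∀ (k₀ : Type) [Field k₀] [PerfectField k₀] (φ : k₀ →+* K) (a : k₀),
      ∃ c : ZMod p, φ a = algebraMap (ZMod p) K c)
    {ι : Type} [Fintype ι] (x : ι → K) (hx : AlgebraicIndependent (ZMod p) x)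
    (h2 : 2 ≤ Fintype.card ι) :
    ¬ ∀ s : Finset K, ∃ (k₀ : Type) (_ : Field k₀) (_ : PerfectField k₀)
      (E : Subfield K) (_ : Algebra k₀ E), Algebra.EssFiniteType k₀ E ∧ (↑s : Set K) ⊆ E ∧
        ∀ u : Finset K, LinearIndepOn E _root_.id (↑u : Set K) →
          LinearIndepOn E (fun y : K => y ^ p) (↑u : Set K) := by
  classical
  intro hk
  have hp : p.Prime := Fact.out
  obtain ⟨k₀, hF, hP, E, hA, hEFT, hsub, hML⟩ := hk (Finset.univ.image x)
  haveI : CharP E p := E.subtype.charP Subtype.val_injective p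
  have hxE : ∀ i, x i ∈ E := fun i => hsub (by simp)
  -- the image of `k₀` is the prime field
  have hφ : ∀ a : k₀, ∃ c : ZMod p, E.subtype (algebraMap k₀ E a) = algebraMap (ZMod p) K c :=
    fun a => hperf k₀ (E.subtype.comp (algebraMap k₀ E)) a
  haveI : CharP k₀ p := (E.subtype.comp (algebraMap k₀ E)).charP
    (E.subtype.comp (algebraMap k₀ E)).injective p
  -- `x` is algebraically independent over `k₀` inside `E`
  set xE : ι → E := fun i => ⟨x i, hxE i⟩ with hxEdef
  have hindE : AlgebraicIndependent k₀ xE :=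
    algebraicIndependent_of_ringHom_eq p E.subtype hφ xE hx
  -- `[E : E^p] = p ^ #t` for a transcendence basis `t` of `E/k₀`, and `#t ≥ 2`
  obtain ⟨t, ht, -, -, hfin⟩ :=
    Literature.FieldTheory.Separability.exists_finrank_frobenius_eq_pow_card (k := k₀) (K := E) p
  have h2t : 2 ≤ t.card := by
    have h1 := hindE.cardinalMk_le_trdeg
    rw [← ht.cardinalMk_eq_trdeg, Cardinal.mk_coe_finset, Cardinal.mk_fintype] at h1
    norm_cast at h1
    exact h2.trans h1
  -- an `E^p`-basis of `E`, moved into `K` by Mac Lane symmetry, has `p ^ #t ≤ p` members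
  haveI : Module.Finite (frobenius E p).fieldRange E :=
    Module.finite_of_finrank_pos (by rw [hfin]; exact pow_pos hp.pos _)
  let b := Module.finBasis (frobenius E p).fieldRange E
  have hbK := linearIndependent_frobenius_of_macLane p E hML b b.linearIndependent
  have hcard := hrank _ _ hbK
  rw [hfin] at hcard
  have h3 : p ^ 2 ≤ p ^ t.card := Nat.pow_le_pow_right hp.pos h2t
  have h4 : p < p ^ 2 := by
    rw [pow_two]
    exact lt_mul_self hp.one_lt
  exact absurd (h3.trans hcard) (not_le.mpr h4)

/-- **`𝔽_p((X))` is not EFT-separably exhausted** (the standard informal inhabitant of the residual class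
of crux `DescentPerfectToAll`, now a kernel theorem): `[𝔽_p((X)) : 𝔽_p((X))^p] ≤ p`, the perfect subfields
of `𝔽_p((X))` are the prime field, and `𝔽_p((X))` has two algebraically independent elements
(`not_exhaustedByEssFiniteType_of_pRank_le_one`). [cite: Matsumura1987, Thm. 26.4 and Thm. 26.5;
EGAIV2, Prop. 6.7.4] -/
theorem not_exhaustedByEssFiniteType_laurentSeries :
    ¬ ∀ s : Finset ((ZMod p)⸨X⸩), ∃ (k₀ : Type) (_ : Field k₀) (_ : PerfectField k₀)
      (E : Subfield ((ZMod p)⸨X⸩)) (_ : Algebra k₀ E), Algebra.EssFiniteType k₀ E ∧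
        (↑s : Set ((ZMod p)⸨X⸩)) ⊆ E ∧
        ∀ u : Finset ((ZMod p)⸨X⸩), LinearIndepOn E _root_.id (↑u : Set ((ZMod p)⸨X⸩)) →
          LinearIndepOn E (fun y : (ZMod p)⸨X⸩ => y ^ p) (↑u : Set ((ZMod p)⸨X⸩)) := by
  haveI : CharP ((ZMod p)⸨X⸩) p :=
    charP_of_injective_algebraMap (algebraMap (ZMod p) ((ZMod p)⸨X⸩)).injective p
  obtain ⟨u₁, u₂, hind⟩ := exists_algebraicIndependent_pair_laurentSeries p
  refine not_exhaustedByEssFiniteType_of_pRank_le_one p ((ZMod p)⸨X⸩)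
    (fun n v hv => by simpa using card_le_of_linearIndependent_frobenius_laurentSeries p v hv)
    (fun k₀ _ _ φ a => ⟨(φ a).coeff 0, ?_⟩) _ hind (by simp)
  rw [show algebraMap (ZMod p) ((ZMod p)⸨X⸩) = HahnSeries.C from Subsingleton.elim _ _]
  exact laurentSeries_ringHom_eq_C_of_perfectField p φ a

/-- **The master class of resolvable ground fields is a proper subclass** (witness of weakness for the
coverage programme of crux `DescentPerfectToAll`): for every prime `p` there is a field `k` of
characteristic `p` in `Type` — namely `𝔽_p((X))` — that is not EFT-separably exhausted, i.e. to which
`hasResolution_of_perfectRes_of_exhaustedByEssFiniteType` does not apply. [folklore] -/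
theorem exists_field_not_exhaustedByEssFiniteType :
    ∃ (k : Type) (_ : Field k) (_ : CharP k p), ¬ ∀ s : Finset k, ∃ (k₀ : Type) (_ : Field k₀)
      (_ : PerfectField k₀) (E : Subfield k) (_ : Algebra k₀ E), Algebra.EssFiniteType k₀ E ∧
        (↑s : Set k) ⊆ E ∧
        ∀ u : Finset k, LinearIndepOn E _root_.id (↑u : Set k) →
          LinearIndepOn E (fun y : k => y ^ p) (↑u : Set k) :=
  ⟨(ZMod p)⸨X⸩, inferInstance,
    charP_of_injective_algebraMap (algebraMap (ZMod p) ((ZMod p)⸨X⸩)).injective p,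
    not_exhaustedByEssFiniteType_laurentSeries p⟩

end Summit.ResolutionOfSingularities.ResolutionOfSingularities.Theorems

end
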